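import Literature.AlgebraicGeometry.Motives.AbelianVarietyBlochPontryaginFiltration
import HarnessLib

/-!
# The Bloch filtration `F^i CH₀(A)` on the `0`-cycles of a complex abelian variety

For an abelian variety `A` over `ℂ`, Bloch (1976) filters the Chow group of `0`-cycles by the
Pontryagin powers of the augmentation ideal: `F^i CH₀(A) := I^{⋆i}`, `I = CH₀(A)_hom`
(Voisin II, §11.3.2, p. 329: "Let `I = CH₀(A)_hom ⊂ CH₀(A)`. Bloch sets
`F^i CH₀(A) = I^{⋆i} ⊂ CH₀(A)`"). Since `I` is spanned, as a group, by the classes `{a} - {0}`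
(`a ∈ A(ℂ)`; closed points = complex points) and `{a} ⋆ {b} = {a + b}` (Voisin II, Def. 11.24),
the ideal `I^{⋆i}` is the subgroup of `CH₀(A)` spanned by the EXPANDED products
`{u} ⋆ ({a₁} - {0}) ⋆ ⋯ ⋆ ({a_m} - {0}) = ± Σ_{S ⊆ {1,…,m}} (-1)^{|S|} {u + Σ_{i ∈ S} aᵢ}`,
`m ≥ i`, `u, aᵢ ∈ A(ℂ)`. The tree has no Pontryagin product on `ChowGroup` (it needs exterior
products of cycles, see the module docstring of `Motives/AbelianVarietyBlochPontryaginFiltration`,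
which files Bloch's theorem `F^{g+1} CH₀(A) = 0` as the named fact
`Bloch1976_pontryaginPower_eq_zero` in exactly this expanded form), so this file DEFINES the
filtration through these generators:

* over an ABSTRACT class map `cls : G → M` from a commutative group to an additive group:
  `blochGen cls u Q s = Σ_{S ⊆ s} (-1)^{|S|} cls (u ∏_{i ∈ S} Qᵢ)` (the expanded product
  `{u} ⋆ ∏_{i ∈ s} ({Qᵢ} - {0})`, sign-normalised) and `blochFiltrationOf cls n` (the subgroup
  generated by the expanded products with at least `n` factors), with their basic calculus:
  splitting off a factor (`blochGen_insert`, `blochGen_update_of_mem`), reindexing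
  (`blochGen_image`, `blochGen_exists_nat`, `blochGen_mem`), monotonicity, the `= ⊥` criterion in
  the format of the named fact (`blochFiltrationOf_eq_bot_iff`), and "translating the base point
  costs one filtration step" (`blochGen_sub_blochGen_mul_mem`);
* for `A : AbelianVariety ℂ` and `cls = AbelianVariety.pointClass A : A(ℂ) → CH₀(A)`, `P ↦ {P}`:
  `AbelianVariety.blochFiltration A n = F^n CH₀(A)`, and the PROVED equivalence
  `bloch1976_pontryaginPower_eq_zero_iff_blochFiltration :
    Bloch1976_pontryaginPower_eq_zero ↔ ∀ A, A.blochFiltration (A.dim + 1) = ⊥`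
  (Voisin II, Thm. 11.29, as a statement about this filtration).

Everything here is proved; no named fact is introduced. The formal skeleton of Voisin's proof of
Thm. 11.29 (Lemmas 11.30–11.32: divisibility of the graded pieces, the assembly
`F^{g+1} = ⋯ = F^N = 0`, transfer along surjections, restriction of the factors to a generating
set) is in `Motives/AbelianVarietyBlochFiltrationSkeleton`.

## What is NOT here

The Pontryagin product itself and the identification `F^n = I^{⋆n}` as IDEALS (only the
generating set is used); the degree map and `F¹ = CH₀(A)_hom`; `F² = ker alb` (Voisin II,
Lemma 11.28); any of the geometry of Bloch's theorem.

## References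

* [VoisinHodgeII2003] C. Voisin, Hodge Theory and Complex Algebraic Geometry II, CUP 2003,
  §11.3.1 Def. 11.24, §11.3.2 pp. 329–331 (Bloch filtration, Thm. 11.29).
* [Bloch1976] S. Bloch, Some elementary theorems about algebraic cycles on Abelian varieties,
  Invent. Math. 37 (1976), 215–228, Thm. 0.1.
-/

noncomputable section

open scoped BigOperators

namespace Literature.AlgebraicGeometry.Motives

/-! ### Expanded Pontryagin products over an abstract class map -/

section Abstract

variable {G : Type*} [CommGroup G] {M : Type*} [AddCommGroup M] (cls : G → M)

/-- The **expanded Pontryagin product** `{u} ⋆ ∏_{i ∈ s} ({Qᵢ} - {0})`, sign-normalised by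
`(-1)^{|s|}`, over an abstract "class map" `cls : G → M` (for `CH₀` of an abelian variety:
`cls a = {a}`, `{a} ⋆ {b} = {ab}`, Voisin II Def. 11.24, group law written multiplicatively):
`blochGen cls u Q s = Σ_{S ⊆ s} (-1)^{|S|} cls (u · ∏_{i ∈ S} Qᵢ)`. The family `Q` may repeat
points; only its values on `s` matter (`blochGen_congr`).
[cite: VoisinHodgeII2003, §11.3.2 p. 329 (F^i CH_0 = I^{*i})] -/
def blochGen {κ : Type*} (u : G) (Q : κ → G) (s : Finset κ) : M :=
  ∑ S ∈ s.powerset, (-1 : ℤ) ^ S.card • cls (u * ∏ i ∈ S, Q i)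

/-- With no factors the expanded product is the class `{u}`. [folklore] -/
theorem blochGen_empty {κ : Type*} (u : G) (Q : κ → G) : blochGen cls u Q ∅ = cls u := by
  simp [blochGen]

/-- **One more factor**: `{u} ⋆ ({Q_a} - {0}) ⋆ Π = {u} ⋆ Π - {u Q_a} ⋆ Π` (up to the sign
normalisation), i.e. splitting the subsets of `insert a s` according to whether they contain `a`.
[folklore] -/
theorem blochGen_insert {κ : Type*} [DecidableEq κ] (u : G) (Q : κ → G) {s : Finset κ} {a : κ}
    (ha : a ∉ s) :
    blochGen cls u Q (insert a s) = blochGen cls u Q s - blochGen cls (u * Q a) Q s := by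
  unfold blochGen
  rw [Finset.sum_powerset_insert ha, sub_eq_add_neg, ← Finset.sum_neg_distrib]
  congr 1
  refine Finset.sum_congr rfl fun t ht => ?_
  have hat : a ∉ t := fun h => ha (Finset.mem_powerset.1 ht h)
  rw [Finset.card_insert_of_notMem hat, Finset.prod_insert hat, pow_succ, mul_neg_one, neg_smul,
    mul_assoc]

/-- The expanded product only depends on the values of the family on `s`. [folklore] -/
theorem blochGen_congr {κ : Type*} (u : G) {Q Q' : κ → G} {s : Finset κ}
    (h : ∀ i ∈ s, Q i = Q' i) : blochGen cls u Q s = blochGen cls u Q' s := by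
  unfold blochGen
  refine Finset.sum_congr rfl fun t ht => ?_
  rw [Finset.prod_congr rfl fun i hi => h i (Finset.mem_powerset.1 ht hi)]

/-- Reindexing the family along a map injective on `s` does not change the expanded product.
[folklore] -/
theorem blochGen_image {κ κ' : Type*} [DecidableEq κ'] (u : G) {Q : κ → G} {Q' : κ' → G}
    {s : Finset κ} {f : κ → κ'} (hf : Set.InjOn f s) (hQ : ∀ i ∈ s, Q' (f i) = Q i) :
    blochGen cls u Q' (s.image f) = blochGen cls u Q s := by
  unfold blochGen
  rw [Finset.powerset_image, Finset.sum_image (Finset.image_injOn_powerset_of_injOn hf)]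
  refine Finset.sum_congr rfl fun t ht => ?_
  have ht' : Set.InjOn f t := hf.mono (by exact_mod_cast Finset.mem_powerset.1 ht)
  rw [Finset.card_image_of_injOn ht', Finset.prod_image ht',
    Finset.prod_congr rfl fun i hi => hQ i (Finset.mem_powerset.1 ht hi)]

/-- Over a finite index type and the full index set, `blochGen` is the alternating sum over ALL
finsets of indices — the format of the named fact `Bloch1976_pontryaginPower_eq_zero`.
[folklore] -/
theorem blochGen_univ {ι : Type*} [Fintype ι] (u : G) (Q : ι → G) :
    blochGen cls u Q Finset.univ = ∑ S : Finset ι, (-1 : ℤ) ^ S.card • cls (u * ∏ i ∈ S, Q i) := by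
  rw [blochGen, Finset.powerset_univ]

/-- Any expanded product is one over the full index set of the finite type `↥s`. [folklore] -/
theorem blochGen_eq_univ_subtype {κ : Type*} (u : G) (Q : κ → G) (s : Finset κ) :
    blochGen cls u Q s = blochGen cls u (fun i : s => Q i) Finset.univ := by
  classical
  have h := blochGen_image cls u (Q := fun i : s => Q i) (Q' := Q) (s := Finset.univ)
    (f := Subtype.val) Subtype.val_injective.injOn (fun i _ => rfl)
  conv at h => lhs; rw [Finset.univ_eq_attach, Finset.attach_image_val]
  exact h

/-- Every expanded product can be reindexed by natural numbers (with the same number of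
factors). [folklore] -/
theorem blochGen_exists_nat {κ : Type*} (Q : κ → G) (s : Finset κ) :
    ∃ (Q' : ℕ → G) (s' : Finset ℕ), s'.card = s.card ∧
      ∀ u, blochGen cls u Q' s' = blochGen cls u Q s := by
  classical
  let e := s.equivFin
  let f : κ → ℕ := fun i => if h : i ∈ s then (e ⟨i, h⟩ : ℕ) else 0
  let Q' : ℕ → G := fun m => if h : m < s.card then Q (e.symm ⟨m, h⟩) else 1
  have hf : Set.InjOn f s := by
    intro i hi j hj hij
    have hi' : i ∈ s := hi
    have hj' : j ∈ s := hj
    simp only [f, dif_pos hi', dif_pos hj'] at hij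
    have := e.injective (Fin.ext hij)
    exact congrArg Subtype.val this
  have hQ : ∀ i ∈ s, Q' (f i) = Q i := by
    intro i hi
    simp only [f, Q', dif_pos hi, dif_pos (e ⟨i, hi⟩).isLt, Fin.eta, Equiv.symm_apply_apply]
  exact ⟨Q', s.image f, Finset.card_image_of_injOn hf, fun u => blochGen_image cls u hf hQ⟩

/-- The **Bloch filtration over an abstract class map**: `blochFiltrationOf cls n` is the subgroup
of `M` generated by the expanded Pontryagin products `{u} ⋆ ∏_{i ∈ s} ({Qᵢ} - {0})` with AT LEAST
`n` factors (families indexed by finite sets of natural numbers; any other indexing gives the same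
elements, `blochGen_mem`). For `cls = (a ↦ {a}) : A(ℂ) → CH₀(A)` this is Bloch's
`F^n CH₀(A) = I^{⋆n}` (Voisin II, §11.3.2, p. 329), see `AbelianVariety.blochFiltration`.
[cite: VoisinHodgeII2003, §11.3.2 p. 329 (F^i CH_0 = I^{*i})] -/
def blochFiltrationOf (n : ℕ) : AddSubgroup M :=
  AddSubgroup.closure
    {x | ∃ (u : G) (Q : ℕ → G) (s : Finset ℕ), n ≤ s.card ∧ blochGen cls u Q s = x}

/-- Expanded products with at least `n` factors (any index type) lie in `F^n`. [folklore] -/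
theorem blochGen_mem {κ : Type*} (u : G) (Q : κ → G) {s : Finset κ} {n : ℕ} (h : n ≤ s.card) :
    blochGen cls u Q s ∈ blochFiltrationOf cls n := by
  obtain ⟨Q', s', hcard, hQ'⟩ := blochGen_exists_nat cls Q s
  rw [← hQ' u]
  exact AddSubgroup.subset_closure ⟨u, Q', s', hcard ▸ h, rfl⟩

/-- The Bloch filtration is decreasing: `F^m ≤ F^n` for `n ≤ m`. [folklore] -/
theorem blochFiltrationOf_antitone : Antitone (blochFiltrationOf cls) := by
  intro n m hnm
  refine (AddSubgroup.closure_le _).2 ?_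
  rintro x ⟨u, Q, s, hs, rfl⟩
  exact blochGen_mem cls u Q (hnm.trans hs)

/-- An induction principle for `F^n`: a property stable under `0`, `+`, `-` holding on the
expanded products with at least `n` factors holds on `F^n`. [folklore] -/
theorem blochFiltrationOf_induction {n : ℕ} {p : M → Prop} (hgen : ∀ (u : G) (Q : ℕ → G)
    (s : Finset ℕ), n ≤ s.card → p (blochGen cls u Q s)) (h0 : p 0)
    (hadd : ∀ x y, p x → p y → p (x + y)) (hneg : ∀ x, p x → p (-x)) {x : M}
    (hx : x ∈ blochFiltrationOf cls n) : p x := by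
  refine AddSubgroup.closure_induction (p := fun y _ => p y) ?_ h0 (fun x y _ _ => hadd x y)
    (fun x _ => hneg x) hx
  rintro y ⟨u, Q, s, hs, rfl⟩
  exact hgen u Q s hs

/-- **`F^n = 0` in the format of the named fact**: `F^n` vanishes iff every alternating sum
`Σ_{S ⊆ ι} (-1)^{|S|} cls (u ∏_{i ∈ S} Qᵢ)` over a finite index type with at least `n` elements
vanishes. [folklore] -/
theorem blochFiltrationOf_eq_bot_iff {n : ℕ} :
    blochFiltrationOf cls n = ⊥ ↔
      ∀ (ι : Type) [Fintype ι], n ≤ Fintype.card ι → ∀ (u : G) (Q : ι → G),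
        ∑ S : Finset ι, (-1 : ℤ) ^ S.card • cls (u * ∏ i ∈ S, Q i) = 0 := by
  constructor
  · intro h ι _ hι u Q
    rw [← blochGen_univ]
    have hmem := blochGen_mem cls u Q (s := Finset.univ) (n := n) (by rwa [Finset.card_univ])
    rw [h] at hmem
    exact (AddSubgroup.mem_bot).1 hmem
  · intro h
    rw [blochFiltrationOf, AddSubgroup.closure_eq_bot_iff]
    rintro x ⟨u, Q, s, hs, rfl⟩
    rw [Set.mem_singleton_iff, blochGen_eq_univ_subtype, blochGen_univ]
    exact h _ (by rwa [Fintype.card_coe]) u _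

/-! ### Translation: `{u} ⋆ Π - {uc} ⋆ Π` has one more factor -/

/-- **Translating the base point costs one filtration step**:
`{u} ⋆ Π - {u c} ⋆ Π = {u} ⋆ ({c} - {0}) ⋆ Π` (up to sign) lies in `F^{|s|+1}` for an expanded
product `Π` with `|s|` factors. [folklore] -/
theorem blochGen_sub_blochGen_mul_mem {κ : Type*} (u c : G) (Q : κ → G) (s : Finset κ) :
    blochGen cls u Q s - blochGen cls (u * c) Q s ∈ blochFiltrationOf cls (s.card + 1) := by
  classical
  obtain ⟨Q', s', hcard, hQ'⟩ := blochGen_exists_nat cls Q s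
  obtain ⟨m, hm⟩ := Infinite.exists_notMem_finset s'
  have hoff : ∀ i ∈ s', Function.update Q' m c i = Q' i :=
    fun i hi => Function.update_of_ne (ne_of_mem_of_not_mem hi hm) _ _
  have key : blochGen cls u (Function.update Q' m c) (insert m s') =
      blochGen cls u Q s - blochGen cls (u * c) Q s := by
    rw [blochGen_insert cls u _ hm, Function.update_self, blochGen_congr cls u hoff,
      blochGen_congr cls (u * c) hoff, hQ', hQ']
  rw [← key]
  exact blochGen_mem cls u _ (by rw [Finset.card_insert_of_notMem hm, hcard])

/-- Changing the value of the family at an index `a ∈ s`: the expanded product splits off the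
factor at `a`. [folklore] -/
theorem blochGen_update_of_mem {κ : Type*} [DecidableEq κ] (u c : G) (Q : κ → G) {s : Finset κ}
    {a : κ} (ha : a ∈ s) :
    blochGen cls u (Function.update Q a c) s =
      blochGen cls u Q (s.erase a) - blochGen cls (u * c) Q (s.erase a) := by
  have hoff : ∀ i ∈ s.erase a, Function.update Q a c i = Q i :=
    fun i hi => Function.update_of_ne (Finset.ne_of_mem_erase hi) _ _
  conv_lhs => rw [← Finset.insert_erase ha]
  rw [blochGen_insert cls u _ (Finset.notMem_erase a s), Function.update_self,
    blochGen_congr cls u hoff, blochGen_congr cls (u * c) hoff]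

end Abstract

/-! ### The Bloch filtration of a complex abelian variety -/

section AbelianVariety

open Literature.AlgebraicGeometry.HodgeTheory (height_pt_eq_zero)

variable (A : AbelianVariety ℂ)

/-- The class `{P} ∈ CH₀(A) = ChowGroup A.X.left 0` of a complex point `P ∈ A(ℂ)`: the class of
the closed point `P.pt` under `P` (closed points of the finite-type `ℂ`-scheme `A` are exactly
its complex points; `height P.pt = 0`, `height_pt_eq_zero`). This is the cycle written `{z}` in
Voisin II, §11.3.2 ("we will write `z ∈ A` for the points of `A` and `{z} ∈ CH₀(A)` for the
corresponding cycles"), and the class used by the named fact `Bloch1976_pontryaginPower_eq_zero`.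
[cite: VoisinHodgeII2003, §11.3.2 p. 329] -/
def AbelianVariety.pointClass (P : A.Points ℂ) : ChowGroup A.X.left 0 :=
  ChowGroup.ofPoint P.pt (height_pt_eq_zero P)

/-- **The Bloch filtration `F^n CH₀(A) = I^{⋆n}`** of the Chow group of `0`-cycles of a complex
abelian variety (Bloch 1976; Voisin II, §11.3.2, p. 329: "Let `I = CH₀(A)_hom ⊂ CH₀(A)`. Bloch
sets `F^i CH₀(A) = I^{⋆i}`"), rendered without the Pontryagin product as the subgroup of `CH₀(A)`
generated by the expanded products `{u} ⋆ ({a₁} - {0}) ⋆ ⋯ ⋆ ({a_m} - {0})`, `m ≥ n`,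
`u, aᵢ ∈ A(ℂ)` (`blochFiltrationOf` for the class map `P ↦ {P}`; these products span the ideal
`I^{⋆n}` because `I` is spanned by the `{a} - {0}` and `{a} ⋆ {b} = {ab}`).
[cite: VoisinHodgeII2003, §11.3.2 p. 329 (F^i CH_0 = I^{*i})] -/
def AbelianVariety.blochFiltration (n : ℕ) : AddSubgroup (ChowGroup A.X.left 0) :=
  blochFiltrationOf A.pointClass n

/-- The Bloch filtration is decreasing. [folklore] -/
theorem AbelianVariety.blochFiltration_antitone : Antitone A.blochFiltration :=
  blochFiltrationOf_antitone _

/-- `F⁰ CH₀(A)` contains every point class `{P}`. [folklore] -/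
theorem AbelianVariety.pointClass_mem_blochFiltration_zero (P : A.Points ℂ) :
    A.pointClass P ∈ A.blochFiltration 0 := by
  have h := blochGen_mem A.pointClass P (fun _ : ℕ => (1 : A.Points ℂ)) (s := ∅) (n := 0) le_rfl
  rwa [blochGen_empty] at h

/-- `F¹ CH₀(A)` contains the differences of point classes `{u} - {u P}` (the expanded product
`{u} ⋆ ({P} - {0})` up to sign; these span `I = CH₀(A)_hom`, Voisin II p. 329). [folklore] -/
theorem AbelianVariety.pointClass_sub_mem_blochFiltration_one (u P : A.Points ℂ) :
    A.pointClass u - A.pointClass (u * P) ∈ A.blochFiltration 1 := by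
  have h := blochGen_sub_blochGen_mul_mem A.pointClass u P (fun _ : ℕ => (1 : A.Points ℂ)) ∅
  rwa [blochGen_empty, blochGen_empty] at h

/-- **Bloch's theorem is the statement `F^{dim A + 1} CH₀(A) = 0` for the filtration defined
here**: the named fact `Bloch1976_pontryaginPower_eq_zero` (Bloch 1976, Thm. 0.1; Voisin II,
Thm. 11.29: "The Bloch filtration `F^i CH₀(A)` satisfies `F^{g+1} CH₀(A) = 0`, `g = dim A`",
filed in expanded form) is equivalent to the vanishing of `AbelianVariety.blochFiltration A
(A.dim + 1)` for every complex abelian variety `A`. [cite: VoisinHodgeII2003, Thm. 11.29] -/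
theorem bloch1976_pontryaginPower_eq_zero_iff_blochFiltration :
    Bloch1976_pontryaginPower_eq_zero ↔
      ∀ A : AbelianVariety ℂ, A.blochFiltration (A.dim + 1) = ⊥ := by
  constructor
  · intro h A
    rw [AbelianVariety.blochFiltration, blochFiltrationOf_eq_bot_iff]
    intro ι _ hι u Q
    exact h A ι hι u Q
  · intro h A ι _ hι R Q
    exact (blochFiltrationOf_eq_bot_iff A.pointClass).1 (h A) ι hι R Q

end AbelianVariety

end Literature.AlgebraicGeometry.Motives

end
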